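import Literature.NumberTheory.EllipticCurves.BernoulliMeasureCongruenceProofs
import HarnessLib

/-!
# The twisted Bernoulli measures `θ E_{k,c}` on `ℤ_p`: boundedness, moments, total mass
# (Lang Ch. 2 §2, Theorems 2.1, 2.2, 2.4)

For an odd prime `p`, a period `N`, an integer `c` prime to `Np` and an `N`-periodic function
`θ : ℕ → ℤ_p`, the distributions `μ_k = θ E_{k,c}` on `ℤ_p`
(`bernoulliMeasure p N c θ k`, `BernoulliMeasureProofs`) satisfy:

* `norm_bernoulliMeasure_one_le_one` — `‖μ_1(a + p^nℤ_p)‖_p ≤ 1` (Lang Thm. 2.1 (i): `E_{1,c}` is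
  `p`-integral, i.e. `θE_{1,c}` is a MEASURE);
* `exists_norm_bernoulliMeasure_sub_le` — `‖μ_k(a + p^nℤ_p) − a^{k-1} μ_1(a + p^nℤ_p)‖_p ≤ C p^{-n}`
  (Lang Thm. 2.1 (ii) / Thm. 2.2 "`E_{k,c} = x^{k-1}E_{1,c}`": `μ_k` is the `(k−1)`-st moment
  distribution of `μ_1` in the sense of the tree's `PAdicMeasureMoments`);
* `bernoulliMeasure_zero_eq` — the total mass
  `μ_k(ℤ_p) = (1/k)(1 − θ(c)c^k) · ∑_{b mod N} θ(b) N^{k-1}B_k(b/N)` when `θ(cx) = θ(c)θ(x)`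
  (the change of variables `x ↦ cx` in Lang's proof of Thm. 2.4,
  `(1/k)B_{k,ψ} = (1 − ψ(c)c^k)⁻¹ ∫ ψ x^{k-1} dE_{1,c}`);
* `bernoulliMeasure_one_zero_eq_zero` — `μ_k(pℤ_p) = 0` when `θ` vanishes on the multiples of `p`
  (a character "extended by `0`", so that the integral is over `ℤ_p^*`).

Everything is proved; there are no named facts.

## References

* S. Lang, *Cyclotomic Fields I and II*, GTM 121, Springer 1990, Ch. 2 §2, Theorems 2.1, 2.2, 2.4
  (PDF pp. 36–38); Ch. 4 §3 (PDF p. 84). [LangCyclotomic1990]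
-/

noncomputable section

open Finset Nat

namespace Literature.NumberTheory.EllipticCurves

variable (p : ℕ) [Fact p.Prime] {N : ℕ} [NeZero N] {c : ℕ} {θ : ℕ → ℤ_[p]}

/-! ### Boundedness -/

omit [Fact p.Prime] [NeZero N] in
/-- `c` prime to `Np` is prime to every `N p^n`. [folklore] -/
private theorem coprime_mul_pow (hc : c.Coprime (N * p)) (n : ℕ) : c.Coprime (N * p ^ n) :=
  Nat.Coprime.mul_right (Nat.Coprime.coprime_mul_right_right hc)
    (Nat.Coprime.pow_right _ (Nat.Coprime.coprime_mul_left_right hc))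

/-- **`θ E_{1,c}` is a measure (bounded by `1`)** at an odd prime `p` (Lang Ch. 2 §2 Thm. 2.1 (i):
the values of `E_{1,c}^{(M)}` are `p`-integral; `θ` has values in `ℤ_p`).
[cite: LangCyclotomic1990, Ch. 2 §2, Thm. 2.1 (i) (PDF p. 36)] -/
theorem norm_bernoulliMeasure_one_le_one (hp : p ≠ 2) (hc : c.Coprime (N * p)) (n : ℕ)
    (a : ZMod (p ^ n)) : ‖bernoulliMeasure p N c θ 1 n a‖ ≤ 1 := by
  unfold bernoulliMeasure
  refine IsUltrametricDist.norm_sum_le_of_forall_le_of_nonneg zero_le_one fun b _ ↦ ?_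
  rw [norm_mul, Nat.cast_one, div_one]
  calc _ ≤ (1 : ℝ) * 1 := by
        gcongr
        · exact (PadicInt.padic_norm_e_of_padicInt _).le.trans (PadicInt.norm_le_one _)
        · exact norm_regBernoulliDist_one_le_one p hp (coprime_mul_pow p hc n) b
    _ = 1 := one_mul _

/-! ### The moment estimate (Theorem 2.2 in finite terms) -/

/-- On the fibre of `a ∈ ℤ/p^nℤ` in `ℤ/Np^nℤ`: `‖b.val^j − a.val^j‖_p ≤ p^{-n}`
(`b.val ≡ a.val mod p^n`). [folklore] -/
private theorem norm_val_pow_sub_le {n : ℕ} {a : ZMod (p ^ n)} {b : ZMod (N * p ^ n)}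
    (hb : ZMod.castHom (Dvd.intro_left N rfl) (ZMod (p ^ n)) b = a) (j : ℕ) :
    ‖((b.val : ℚ_[p])) ^ j - ((a.val : ℚ_[p])) ^ j‖ ≤ (p : ℝ) ^ (-(n : ℤ)) := by
  have hmod : b.val % p ^ n = a.val := by
    have h := congr_arg ZMod.val hb
    rwa [ZMod.castHom_apply, ZMod.cast_eq_val, ZMod.val_natCast] at h
  have hdvd : ((p : ℤ) ^ n : ℤ) ∣ (b.val : ℤ) ^ j - (a.val : ℤ) ^ j := by
    refine dvd_trans ?_ (sub_dvd_pow_sub_pow (b.val : ℤ) (a.val : ℤ) j)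
    refine ⟨(b.val / p ^ n : ℕ), ?_⟩
    have h := Nat.div_add_mod b.val (p ^ n)
    rw [hmod] at h
    push_cast
    linarith [show ((p : ℤ) ^ n * (b.val / p ^ n : ℕ) + a.val : ℤ) = b.val by exact_mod_cast h]
  obtain ⟨m, hm⟩ := hdvd
  have e : ((b.val : ℚ_[p])) ^ j - ((a.val : ℚ_[p])) ^ j = ((p : ℚ_[p]) ^ n) * (m : ℚ_[p]) := by
    exact_mod_cast hm
  rw [e, norm_mul, norm_pow, Padic.norm_p, inv_pow, ← zpow_natCast, ← zpow_neg]
  have hp0 : (0 : ℝ) ≤ (p : ℝ) ^ (-(n : ℤ)) := zpow_nonneg (Nat.cast_nonneg p) _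
  calc _ ≤ (p : ℝ) ^ (-(n : ℤ)) * 1 :=
        mul_le_mul_of_nonneg_left (Padic.norm_int_le_one m) hp0
    _ = _ := mul_one _

/-- **Lang Ch. 2 §2, Thm. 2.1 (ii) / Thm. 2.2 (`E_{k,c} = x^{k-1} E_{1,c}` as measures on `ℤ_p`), in
finite terms**: for an odd prime `p`, `k ≥ 1`, `c` prime to `Np` and an `N`-periodic `θ`, there is
`C ≥ 1` with
`‖(θE_{k,c})(a + p^nℤ_p) − a.val^{k-1} · (θE_{1,c})(a + p^nℤ_p)‖_p ≤ C p^{-n}` for all `n`, `a` —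
the hypothesis of the tree's moment lemma `tendsto_sum_units_mul_pow_of_moment`.
[cite: LangCyclotomic1990, Ch. 2 §2, Thm. 2.1 (ii) and Thm. 2.2 (PDF pp. 36–37)] -/
theorem exists_norm_bernoulliMeasure_sub_le (hp : p ≠ 2) (hc : c.Coprime (N * p)) {k : ℕ}
    (hk : 1 ≤ k) :
    ∃ C : ℝ, 1 ≤ C ∧ ∀ (n : ℕ) (a : ZMod (p ^ n)),
      ‖bernoulliMeasure p N c θ k n a - ((a.val : ℕ) : ℚ_[p]) ^ (k - 1) * bernoulliMeasure p N c θ 1 n a‖ ≤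
        C * (p : ℝ) ^ (-(n : ℤ)) := by
  obtain ⟨D, hD1, hD⟩ := exists_norm_regBernoulliDist_sub_le p hp hk
  have hk0 : (k : ℚ_[p]) ≠ 0 := by exact_mod_cast (show k ≠ 0 by omega)
  have hknorm : 0 < ‖(k : ℚ_[p])‖ := norm_pos_iff.mpr hk0
  have hknorm1 : ‖(k : ℚ_[p])‖ ≤ 1 := by exact_mod_cast Padic.norm_int_le_one (k : ℤ)
  refine ⟨D / ‖(k : ℚ_[p])‖, ?_, fun n a ↦ ?_⟩
  · rw [le_div_iff₀ hknorm]
    calc 1 * ‖(k : ℚ_[p])‖ ≤ 1 * 1 := by gcongr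
      _ ≤ D := by linarith
  have hp0 : (0 : ℝ) ≤ (p : ℝ) ^ (-(n : ℤ)) := zpow_nonneg (Nat.cast_nonneg p) _
  have hpn : ‖((N * p ^ n : ℕ) : ℚ_[p])‖ ≤ (p : ℝ) ^ (-(n : ℤ)) := by
    push_cast
    rw [norm_mul, norm_pow, Padic.norm_p, inv_pow, ← zpow_natCast, ← zpow_neg]
    calc _ ≤ 1 * (p : ℝ) ^ (-(n : ℤ)) :=
          mul_le_mul_of_nonneg_right (by exact_mod_cast Padic.norm_int_le_one (N : ℤ)) hp0
      _ = _ := one_mul _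
  have hDk : 1 ≤ D / ‖(k : ℚ_[p])‖ := by
    rw [le_div_iff₀ hknorm]
    calc 1 * ‖(k : ℚ_[p])‖ ≤ 1 * 1 := by gcongr
      _ ≤ D := by linarith
  have hDk0 : 0 ≤ D / ‖(k : ℚ_[p])‖ := zero_le_one.trans hDk
  have hCD : (p : ℝ) ^ (-(n : ℤ)) ≤ D / ‖(k : ℚ_[p])‖ * (p : ℝ) ^ (-(n : ℤ)) :=
    le_mul_of_one_le_left hp0 hDk
  unfold bernoulliMeasure
  rw [Finset.mul_sum, ← Finset.sum_sub_distrib]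
  refine IsUltrametricDist.norm_sum_le_of_forall_le_of_nonneg (mul_nonneg hDk0 hp0) fun b hb ↦ ?_
  have hb' := (Finset.mem_filter.mp hb).2
  set x := ((θ b.val : ℤ_[p]) : ℚ_[p]) with hx
  have hxle : ‖x‖ ≤ 1 := (PadicInt.padic_norm_e_of_padicInt _).le.trans (PadicInt.norm_le_one _)
  set Ek := ((regBernoulliDist k (N * p ^ n) c b : ℚ) : ℚ_[p]) with hEk
  set E1 := ((regBernoulliDist 1 (N * p ^ n) c b : ℚ) : ℚ_[p]) with hE1
  have hbound : ‖x * ((k : ℚ_[p])⁻¹ * (Ek - (k : ℚ_[p]) * ((b.val : ℚ_[p])) ^ (k - 1) * E1) +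
        (((b.val : ℚ_[p])) ^ (k - 1) - ((a.val : ℚ_[p])) ^ (k - 1)) * E1)‖ ≤
      D / ‖(k : ℚ_[p])‖ * (p : ℝ) ^ (-(n : ℤ)) := by
    rw [norm_mul]
    calc ‖x‖ * _ ≤ 1 * (D / ‖(k : ℚ_[p])‖ * (p : ℝ) ^ (-(n : ℤ))) := by
          refine mul_le_mul hxle ?_ (norm_nonneg _) zero_le_one
          refine (IsUltrametricDist.norm_add_le_max _ _).trans (max_le ?_ ?_)
          · rw [norm_mul, norm_inv]
            have h1 := (hD (N * p ^ n) c (coprime_mul_pow p hc n) b).trans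
              (mul_le_mul_of_nonneg_left hpn (by linarith))
            calc ‖(k : ℚ_[p])‖⁻¹ * _ ≤ ‖(k : ℚ_[p])‖⁻¹ * (D * (p : ℝ) ^ (-(n : ℤ))) :=
                  mul_le_mul_of_nonneg_left h1 (inv_nonneg.mpr (norm_nonneg (k : ℚ_[p])))
              _ = _ := by rw [div_eq_mul_inv]; ring
          · rw [norm_mul]
            calc _ ≤ (p : ℝ) ^ (-(n : ℤ)) * 1 :=
                  mul_le_mul (norm_val_pow_sub_le p hb' (k - 1))
                    (norm_regBernoulliDist_one_le_one p hp (coprime_mul_pow p hc n) b)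
                    (norm_nonneg _) hp0
              _ ≤ _ := by rw [mul_one]; exact hCD
      _ = _ := one_mul _
  refine (congrArg (‖·‖) ?_).trans_le hbound
  rw [hx, hEk, hE1]
  push_cast
  field_simp
  ring

/-! ### Total mass: Lang Thm. 2.4 (the change of variables `x ↦ cx`) -/

omit [NeZero N] in
/-- An `N`-periodic function is constant on residue classes modulo any multiple of `N`. [folklore] -/
private theorem apply_eq_of_modEq {M : ℕ} (hNM : N ∣ M) (hθ : ∀ b, θ (b + N) = θ b) {x y : ℕ}
    (h : x ≡ y [MOD M]) : θ x = θ y := by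
  have hper : ∀ b m : ℕ, θ (b + m * N) = θ b := by
    intro b m
    induction m with
    | zero => rw [zero_mul, add_zero]
    | succ m ih => rw [Nat.succ_mul, ← add_assoc, hθ, ih]
  obtain ⟨d, rfl⟩ := hNM
  have hx : θ x = θ (x % (N * d)) := by
    conv_lhs => rw [← Nat.mod_add_div x (N * d),
      show N * d * (x / (N * d)) = (d * (x / (N * d))) * N by ring, hper]
  have hy : θ y = θ (y % (N * d)) := by
    conv_lhs => rw [← Nat.mod_add_div y (N * d),
      show N * d * (y / (N * d)) = (d * (y / (N * d))) * N by ring, hper]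
  rw [hx, hy]
  exact congrArg θ h

omit [NeZero N] in
/-- **Change of variables `x ↦ cx`** (Lang Ch. 2 §2, proof of Thm. 2.4: "We let `x ↦ cx` in the
second integral. Then `ψ(c)` comes out as a factor"): for `θ` with `θ(cx) = θ(c)θ(x)`, `N ∣ M`,
`c` prime to `M`, `∑_{b mod M} θ(b) M^{k-1}B_k((bc⁻¹).val/M) = θ(c) ∑_{b mod M} θ(b) M^{k-1}B_k(b.val/M)`.
[cite: LangCyclotomic1990, Ch. 2 §2, proof of Thm. 2.4 (PDF p. 38)] -/
theorem sum_mul_bernoulliDist_mul_inv {M : ℕ} [NeZero M] (hNM : N ∣ M) (hcM : c.Coprime M)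
    (hθ : ∀ b, θ (b + N) = θ b) (hθc : ∀ x, θ (c * x) = θ c * θ x) (k : ℕ) :
    ∑ b : ZMod M, ((θ b.val : ℤ_[p]) : ℚ_[p]) * ((bernoulliDist k M (b * (c : ZMod M)⁻¹) : ℚ) : ℚ_[p]) =
      ((θ c : ℤ_[p]) : ℚ_[p]) *
        ∑ b : ZMod M, ((θ b.val : ℤ_[p]) : ℚ_[p]) * ((bernoulliDist k M b : ℚ) : ℚ_[p]) := by
  have hcc : (c : ZMod M) * (c : ZMod M)⁻¹ = 1 := ZMod.coe_mul_inv_eq_one c hcM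
  set u : (ZMod M)ˣ := ZMod.unitOfCoprime c hcM with hu
  rw [Finset.mul_sum, ← Equiv.sum_comp (Units.mulRight u)]
  refine Finset.sum_congr rfl fun b _ ↦ ?_
  rw [Units.mulRight_apply, hu, ZMod.coe_unitOfCoprime, mul_assoc, hcc, mul_one, ← mul_assoc]
  congr 1
  rw [← PadicInt.coe_mul, ← hθc]
  congr 1
  refine apply_eq_of_modEq p hNM hθ ?_
  calc (b * (c : ZMod M)).val = b.val * (c % M) % M := by rw [ZMod.val_mul, ZMod.val_natCast]
    _ ≡ b.val * (c % M) [MOD M] := Nat.mod_modEq _ _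
    _ ≡ b.val * c [MOD M] := (Nat.mod_modEq c M).mul_left _
    _ = c * b.val := mul_comm _ _

/-- **Total mass of `θE_{k,c}`** (Lang Ch. 2 §2, Thm. 2.4:
`(1/k)B_{k,ψ} = (1 − ψ(c)c^k)⁻¹ ∫ ψ(a)a^{k-1} dE_{1,c}(a)`, here before Thm. 2.2 is applied, i.e.
`∫ ψ dE_{k,c} = (1/k)(1 − ψ(c)c^k) B_{k,ψ}`): for `θ` multiplicative with respect to `c`,
`(θE_{k,c})(ℤ_p) = (1/k)(1 − θ(c)c^k) ∑_{b mod N} θ(b) N^{k-1} B_k(b.val/N)` (the sum written at level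
`N·p^0`). [cite: LangCyclotomic1990, Ch. 2 §2, Thm. 2.4 and its proof (PDF p. 38)] -/
theorem bernoulliMeasure_zero_eq (hc : c.Coprime (N * p)) (hθ : ∀ b, θ (b + N) = θ b)
    (hθc : ∀ x, θ (c * x) = θ c * θ x) (k : ℕ) :
    bernoulliMeasure p N c θ k 0 0 =
      (k : ℚ_[p])⁻¹ * (1 - ((θ c : ℤ_[p]) : ℚ_[p]) * (c : ℚ_[p]) ^ k) *
        ∑ b : ZMod (N * p ^ 0), ((θ b.val : ℤ_[p]) : ℚ_[p]) *
          ((bernoulliDist k (N * p ^ 0) b : ℚ) : ℚ_[p]) := by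
  have hcM : c.Coprime (N * p ^ 0) := coprime_mul_pow p hc 0
  unfold bernoulliMeasure
  have hfil : Finset.univ.filter (fun b : ZMod (N * p ^ 0) ↦
      ZMod.castHom (Dvd.intro_left N rfl) (ZMod (p ^ 0)) b = 0) = Finset.univ := by
    refine Finset.filter_true_of_mem fun b _ ↦ ?_
    haveI : Subsingleton (ZMod (p ^ 0)) := ZMod.subsingleton_iff.mpr (pow_zero p)
    exact Subsingleton.elim _ _
  rw [hfil]
  have hterm : ∀ b : ZMod (N * p ^ 0),
      ((θ b.val : ℤ_[p]) : ℚ_[p]) * (((regBernoulliDist k (N * p ^ 0) c b / k : ℚ)) : ℚ_[p]) =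
        (k : ℚ_[p])⁻¹ * (((θ b.val : ℤ_[p]) : ℚ_[p]) * ((bernoulliDist k (N * p ^ 0) b : ℚ) : ℚ_[p])) -
          (k : ℚ_[p])⁻¹ * (c : ℚ_[p]) ^ k * (((θ b.val : ℤ_[p]) : ℚ_[p]) *
            ((bernoulliDist k (N * p ^ 0) (b * (c : ZMod (N * p ^ 0))⁻¹) : ℚ) : ℚ_[p])) := by
    intro b
    unfold regBernoulliDist
    push_cast
    ring
  rw [Finset.sum_congr rfl fun b _ ↦ hterm b, Finset.sum_sub_distrib, ← Finset.mul_sum,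
    ← Finset.mul_sum, sum_mul_bernoulliDist_mul_inv p (Dvd.intro _ rfl) hcM hθ hθc k]
  ring

/-- **`(θE_{k,c})(pℤ_p) = 0`** when `θ` vanishes on the multiples of `p` (a Dirichlet character of
conductor divisible by `p`, or one depleted at `p`, "extended by `0`": Lang Ch. 2 §2 before Thm. 2.4,
"we define its value to be `0` on elements … which are not prime to `p`", so that
`∫_{ℤ_p} = ∫_{ℤ_p^*}`). [cite: LangCyclotomic1990, Ch. 2 §2, Thm. 2.4 (PDF p. 38)] -/
theorem bernoulliMeasure_one_zero_eq_zero (hθp : ∀ b, p ∣ b → θ b = 0) (k : ℕ) :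
    bernoulliMeasure p N c θ k 1 0 = 0 := by
  unfold bernoulliMeasure
  refine Finset.sum_eq_zero fun b hb ↦ ?_
  have hb' := (Finset.mem_filter.mp hb).2
  have hdvd : p ∣ b.val := by
    have h := congr_arg ZMod.val hb'
    rw [ZMod.castHom_apply, ZMod.cast_eq_val, ZMod.val_natCast, ZMod.val_zero] at h
    exact dvd_trans (dvd_pow_self p one_ne_zero) (Nat.dvd_of_mod_eq_zero h)
  rw [hθp _ hdvd, PadicInt.coe_zero, zero_mul]

end Literature.NumberTheory.EllipticCurves

end
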